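import Summits.ResolutionOfSingularities.ResolutionOfSingularities.Theorems.PurelyInseparableDim4ScopeDescent
import HarnessLib
import HarnessLib.Audit.Tags

/-!
# Purely inseparable fourfolds — F4-C per field is ANTITONE in the field; in-scope branches go up and down
# [OURS · counted 0 · statements about OUR frame (`PurelyInseparableDim4Scope`), not about resolution]

Census cell «res-dim4-pi» (D-0157 DOOR 2), width seat `res-dim4-p-14`, brick PR-12r; the F4-C twin of
PR-12b's `BaseChange.exists_rule_anti`.  Since the coordinate scope is geometric (PR-12i UP, PR-12p DOWN)
and edges go up (PR-12b), along any homomorphism of fields `f : k →+* K`: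

* `inScopeBranch_map` — an infinite in-scope branch of the restricted rule `s ↦ R (s♯)` over `k` maps to
  an infinite in-scope branch of `R` over `K`;
* **`exists_inScopeRule_anti`** — «some permissible rule has no infinite in-scope branch» over `K`
  implies the same over `k`: the per-field F4-C statement is ANTITONE in the field, so the prime field is
  the easiest case and an in-scope trap over `𝔽_p` (PR-12i `forall_exists_inScopeTrap_of_zmod`) is the
  universal kill;
* `terminatesInScope_iff_forall_algClosed` — hence F4-C holds iff it holds over every algebraically
  closed field of characteristic `p` (check it where B is strongest).

Nothing here proves `TerminatesInScope` or resolution of singularities in dimension ≥ 4 / characteristic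
`p`; counted 0; AI work, weaker than expert review.
bears_on: LADDER-RESOLUTION:D157-DOOR2 (res-dim4-pi · PR-12r). Supports stmt-ResolutionOfSingularities-16155
(helper).
-/

set_option linter.dupNamespace false

noncomputable section

namespace Summit.ResolutionOfSingularities.ResolutionOfSingularities.Theorems.PIDim4

namespace ScopeRuleAnti

open Literature.AlgebraicGeometry.Resolution

variable {k K : Type} [Field k] [Field K] [DecidableEq k] [DecidableEq K] (f : k →+* K)

/-- An in-scope branch of the restricted rule over `k` maps to an in-scope branch of `R` over `K`.
[folklore] -/
theorem inScopeBranch_map {q : ℕ} {R : CentreRule K} {c : ℕ → State k}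
    (hc : ∀ n, InCoordinateScope q (c n).F ∧
      StepRule q (fun s : State k => R ⟨MvPolynomial.map f s.F, s.r, s.exc⟩) (c n) (c (n + 1))) :
    ∀ n, InCoordinateScope q ((⟨MvPolynomial.map f (c n).F, (c n).r, (c n).exc⟩ : State K)).F ∧
      StepRule q R (⟨MvPolynomial.map f (c n).F, (c n).r, (c n).exc⟩ : State K)
        ⟨MvPolynomial.map f (c (n + 1)).F, (c (n + 1)).r, (c (n + 1)).exc⟩ := fun n =>
  ⟨ScopeBaseChange.inCoordinateScope_map f (hc n).1,
    (BaseChange.isPermissibleCentre_map_iff f q _ (c n).F).mpr (hc n).2.1,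
    BaseChange.edge_map f (hc n).2.2⟩

include f in
/-- **The per-field F4-C statement is antitone in the field**: if over `K` some permissible rule has no
infinite in-scope branch, then over `k` its restriction has none. [folklore] -/
theorem exists_inScopeRule_anti {q : ℕ}
    (h : ∃ R : CentreRule K, IsPermissibleRule q R ∧
      ¬ ∃ c : ℕ → State K, ∀ n, InCoordinateScope q (c n).F ∧ StepRule q R (c n) (c (n + 1))) :
    ∃ R : CentreRule k, IsPermissibleRule q R ∧
      ¬ ∃ c : ℕ → State k, ∀ n, InCoordinateScope q (c n).F ∧ StepRule q R (c n) (c (n + 1)) := by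
  obtain ⟨R, hR, hT⟩ := h
  refine ⟨fun s => R ⟨MvPolynomial.map f s.F, s.r, s.exc⟩, BaseChange.isPermissibleRule_comap f hR, ?_⟩
  rintro ⟨c, hc⟩
  exact hT ⟨fun n => ⟨MvPolynomial.map f (c n).F, (c n).r, (c n).exc⟩, inScopeBranch_map f hc⟩

omit [DecidableEq k] [DecidableEq K] f in
/-- **F4-C may be checked over algebraically closed fields**: `TerminatesInScope p q` iff over every
algebraically closed field of characteristic `p` some permissible rule has no infinite in-scope branch.
[folklore] -/
theorem terminatesInScope_iff_forall_isAlgClosed (p q : ℕ) :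
    TerminatesInScope p q ↔
      ∀ (L : Type) [Field L] [IsAlgClosed L] [CharP L p] [DecidableEq L],
        ∃ R : CentreRule L, IsPermissibleRule q R ∧
          ¬ ∃ c : ℕ → State L, ∀ n, InCoordinateScope q (c n).F ∧ StepRule q R (c n) (c (n + 1)) := by
  refine ⟨fun h L _ _ _ _ => h L, fun h K _ _ _ => ?_⟩
  letI : DecidableEq (AlgebraicClosure K) := Classical.decEq _
  exact exists_inScopeRule_anti (algebraMap K (AlgebraicClosure K)) (h (AlgebraicClosure K))

end ScopeRuleAnti

end Summit.ResolutionOfSingularities.ResolutionOfSingularities.Theorems.PIDim4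

end
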